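import Summits.HodgeConjecture.HodgeConjecture.Theses.BoundaryReadout
import Summits.HodgeConjecture.HodgeConjecture.Theorems.BoundaryReadoutPullbackAlgebraic
import Summits.HodgeConjecture.HodgeConjecture.Theorems.BoundaryReadoutAbsoluteReductionOfFacts
import Summits.HodgeConjecture.HodgeConjecture.Theorems.BoundaryReadoutBoundaryAbsolutenessSplit
import Summits.HodgeConjecture.HodgeConjecture.Theorems.BoundaryReadoutBoundarySupplyConstantFamily
import Summits.HodgeConjecture.HodgeConjecture.Theorems.BoundaryReadoutHCOverNumberFieldsSplit
import HarnessLib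

/-!
# Route `BoundaryReadout` — composition audit (compose pass, 2026-08-17)

Machine-checked record of what the deciding theorem `BoundaryReadout.closes` still needs once every
PROVED decl of the tree is plugged in.  Of its five hypotheses only `PullbackAlgebraic` is a theorem
(`boundaryReadout_pullbackAlgebraic_proof`); the other four are open, and the best in-tree roads to
them are conditional on the antecedents listed as hypotheses below (none of which has a proof in the
tree).  Pure composition — no new mathematics.
-/

set_option linter.dupNamespace false

noncomputable section

open CategoryTheory AlgebraicGeometry
open Literature.AlgebraicGeometry.Motives Literature.AlgebraicGeometry.HodgeTheory
open Summit.HodgeConjecture.HodgeConjecture.Theses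

namespace Summit.HodgeConjecture.HodgeConjecture.Theorems

/-- **Residual leaf set of route `BoundaryReadout` (named-fact form).** The summit statement follows
from: the two bare cruxes `BoundarySupply` (stmt-15912) and `HCOverNumberFields` (stmt-1070), the four
named Literature facts of conjugation (J) `jouanolou_cohomologyChart`, (G)
`grothendieck_comparison_realize_surjective`, (C) `conj_realize_mem_cclosedSmoothForms`, (N)
`chartConjugation_canonical` (which give `BoundaryAbsoluteness`, stmt-15913, by
`boundaryAbsoluteness_of_facts`), and the two named facts `voisin2007_flatSpread_of_isAbsoluteHodgeClass`,
`deligne_globalInvariantCycles` (which with the PROVED `fulton1998_map_mem_algebraicClasses_holds` give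
`AbsoluteReduction`, stmt-15945, by `absoluteReduction_of_literatureFacts`); `PullbackAlgebraic`
(stmt-1071) is the theorem `boundaryReadout_pullbackAlgebraic_proof`.  CONDITIONAL on all eight.
[cite: Voisin2007HodgeLoci, Prop. 1.2] [cite: CharlesSchnell2014Notes, §11.2.2 and Thm. 11.3.19] -/
theorem hodgeConjecture_of_boundaryReadout_leaves
    (hS : BoundaryReadout.BoundarySupply) (hQ : BoundaryReadout.HCOverNumberFields)
    (hJ : jouanolou_cohomologyChart) (hG : grothendieck_comparison_realize_surjective)
    (hC : conj_realize_mem_cclosedSmoothForms) (hN : chartConjugation_canonical)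
    (hAS : voisin2007_flatSpread_of_isAbsoluteHodgeClass) (hD : deligne_globalInvariantCycles) :
    _root_.HodgeConjecture :=
  BoundaryReadout.closes hS (boundaryAbsoluteness_of_facts hJ hG hC hN) hQ
    (absoluteReduction_of_literatureFacts hAS hD fulton1998_map_mem_algebraicClasses_holds)
    boundaryReadout_pullbackAlgebraic_proof

/-- **Residual leaf set of route `BoundaryReadout` (item form).** The same with the engine crux
replaced by its two filed children `ConjugateClassesExist` (stmt-18339) and `ConjugationNatural`
(stmt-18340) via the accepted glue `boundaryAbsoluteness_of_subs`, and `AbsoluteReduction` replaced by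
Voisin's flat spread + the route item `LinearSystemTorelli.DeligneGlobalInvariantCycles` (stmt-16363)
via `absoluteReduction_of_flatSpread`.  CONDITIONAL on all six.
[cite: Voisin2007HodgeLoci, Prop. 1.2] [cite: CharlesSchnell2014Notes, §11.2.2] -/
theorem hodgeConjecture_of_boundaryReadout_items
    (hS : BoundaryReadout.BoundarySupply) (hQ : BoundaryReadout.HCOverNumberFields)
    (h₁ : ∀ ⦃n : ℕ⦄ ⦃X : SchemeOver ℂ⦄, IsSmoothProjective n X →
      ∀ (σ : ℂ ≃+* ℂ) (k : ℕ) (c : complexBetti X k), ∃ c', IsConjugateClass σ X k c c')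
    (h₂ : ∀ ⦃m n : ℕ⦄ ⦃Y X : SchemeOver ℂ⦄, IsSmoothProjective m Y → IsSmoothProjective n X →
      ∀ (g : Y ⟶ X) (σ : ℂ ≃+* ℂ) (k : ℕ) (c : complexBetti X k)
        (c' : complexBetti (conjugateVariety σ X) k) (d' : complexBetti (conjugateVariety σ Y) k),
        IsConjugateClass σ X k c c' → IsConjugateClass σ Y k (complexBetti.map g k c) d' →
          d' = complexBetti.map (conjHom σ g) k c')
    (hAS : voisin2007_flatSpread_of_isAbsoluteHodgeClass)
    (hD : LinearSystemTorelli.DeligneGlobalInvariantCycles) :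
    _root_.HodgeConjecture :=
  BoundaryReadout.closes hS (boundaryAbsoluteness_of_subs h₁ h₂) hQ
    (absoluteReduction_of_flatSpread hAS hD boundaryReadout_pullbackAlgebraic_proof)
    boundaryReadout_pullbackAlgebraic_proof

/-- **The two bare cruxes collapse under Conj. 11.2.17.** If every rational `(p,p)` class is absolute
Hodge (Charles–Schnell Conj. 11.2.17), `BoundarySupply` is the constant family
(`boundarySupply_of_hodgeClassesAbsolute`), so the route then needs only `HCOverNumberFields` and the
six named facts.  CONDITIONAL. [cite: CharlesSchnell2014Notes, Conj. 11.2.17] -/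
theorem hodgeConjecture_of_hodgeClassesAbsolute_of_leaves
    (h17 : ∀ ⦃n : ℕ⦄ ⦃X : SchemeOver ℂ⦄, IsSmoothProjective n X →
      ∀ (p : ℕ) (c : complexBetti X (2 * p)), IsRationalClass c → IsOfHodgeType n X (2 * p) p p c →
        IsAbsoluteHodgeClass n X p c)
    (hQ : BoundaryReadout.HCOverNumberFields)
    (hJ : jouanolou_cohomologyChart) (hG : grothendieck_comparison_realize_surjective)
    (hC : conj_realize_mem_cclosedSmoothForms) (hN : chartConjugation_canonical)
    (hAS : voisin2007_flatSpread_of_isAbsoluteHodgeClass) (hD : deligne_globalInvariantCycles) :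
    _root_.HodgeConjecture :=
  hodgeConjecture_of_boundaryReadout_leaves (boundarySupply_of_hodgeClassesAbsolute h17) hQ hJ hG hC hN
    hAS hD

end Summit.HodgeConjecture.HodgeConjecture.Theorems

end
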